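import Summits.QuantumFields.YangMills.Theorems.BalabanUVNodesN15KingModelGraphPowerCountingKruskal

/-!
# BalabanUVNodes ∕ N15 — THE KING-MODEL RUNG (PART Δ-a): **THE SUBGRAPHS `H_i` OF AN ORDERING SPLIT INTO THEIR POINTS** — King's degree `D(H_i)` of the first
# `i` lines of an ordering (partial sum of `e_ℓ + dV·[l reaches a new point]`) IS the sum, over the points of the shrunk graph, of the degrees
# `dV·(|V(S)| − 1) + Σ_{ℓ∈S} e_ℓ` of the CONNECTED NON-EMPTY sub-line-sets `S` lying in each point; hence King's ordering-free sentence «every subgraph has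
# positive degree» (p. 664) bounds every `D(H_i)` from below — the combinatorial bridge from §3.4's subgraph condition to (3.77)
# (Track A, DAG node N15 = NE2; FAN-OUT v1.1 §N15 s3 «KING-MODEL RUNG … NE2's analogue DECIDED in the model»)

HONEST FRAMING.  Count-neutral (cell `pub-ymgap`, seat `pub-ymgap-dag-n15-e` g28; `--supports stmt-QuantumFields-27366 --as helper` = K3⁸
`SpineGivenEndpointR13SepCoPHV`).  TEMPLATE LITERATURE: C. King, *The U(1) Higgs model. I. The continuum limit*, Commun. Math. Phys. **102** (1986) 649–677
[King1986], proof of Proposition 3.6, §3.4 pp. 663–664 and §3.5 (3.77) p. 666.  Part Γ-k typed King's shrinking procedure along an ordering as Kruskal's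
component labels `klab` (tree positions, `kruskalTreeUpTo`, `LConn`, ★★ `card_image_klab_add`, ★★ `lConn_of_klab_eq`); part Γ-l proved Prop. 3.6 (3.56) for
connected graphs under the hypothesis that King's degrees `D(H_i)` are positive (with a margin) ALONG EVERY ORDERING.  King states the hypothesis ORDERING-FREE:
«renormalised graphs, in which every subgraph has positive degree».  THIS FILE proves the finite combinatorial identity behind that sentence: the subgraph `H_i`
of the first `i` lines splits into the points of the shrunk graph; each point carries a non-empty CONNECTED sub-line-set; `#tree lines(i) + #points(H_i) =
|V(H_i)|`; and `D(H_i) = Σ_points D(S_point)`.  So a lower bound `γ₁` on the degree of every non-empty connected sub-line-set is a lower bound on every `D(H_i)`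
along every ordering (part Δ-b turns this into `PosDegreesBy γ₁ (kingDegList …)` and into Prop. 3.6 under the subgraph condition).  Elementary combinatorics on
`Fin (nn+1)`; King's U(1)∕`A = 0` model bookkeeping; NOT Bałaban's `G(U)`; NOT a node discharge; nothing continuum ∕ ℝ⁴ ∕ OS ∕ mass-gap ∕ Clay.  0 `sorry`;
standard axioms.
THE PRINT.  p. 663 [PDF 15] (foot): *«H₁ = {the line l(1) and its two vertices}, H_{i+1} = H_i ∪ {the line l(i+1) and its two vertices}. (3.66)»*; p. 664 [PDF 16]:
*«In order that this procedure work, it is necessary that every subgraph have positive degree D. Some of the subgraphs H_i may be divergent. In Sect. 3.5, we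
will show how graphs may be added together to form renormalised graphs, in which every subgraph has positive degree. We will assume below that this has been done
already … Graphically, we have shrunk l(1) to a point in H … eventually shrinking H to one point x.»*; p. 666 [PDF 18]: *«(i) D(H_i) > 0 for 1 ≤ i ≤ m₁ (3.77)»*.
WHAT THIS FILE PROVES (namespace `…N15KingModelRung.Graph`; vertices `Fin (nn+1)`, lines `Fin m` with `src`, `tgt`; ordering `π`; `i` = number of lines shrunk).
* `lineVerts S` (the vertices of a line set), `prefixLines π i` (the lines of `H_i`), `labelLines π i c` (the lines of `H_i` inside the point `c`), `subDeg dV e S`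
  (KING's DEGREE OF A SUB-LINE-SET `dV·(|V(S)| − 1) + Σ_{ℓ∈S} e_ℓ`), `prefixDeg dV e π i` (`D(H_i)`), `PosSubgraphsBy γ₁ dV e` (EVERY NON-EMPTY CONNECTED SUB-LINE-SET HAS
  DEGREE `> γ₁` — King's «every subgraph has positive degree», with a margin).
* letters `mem_lineVerts`, `src_mem_lineVerts`, `tgt_mem_lineVerts`, `lineVerts_mono`, ★ `lConn_eq_or_mem_lineVerts` (connected through `T` ⇒ equal or both on
  `T`), `mem_prefixLines`, `apply_mem_prefixLines`, `kruskalTreeUpTo_subset_prefixLines`, `klab_ends_eq_of_mem_prefixLines`, ★ `lConn_labelLines_of_lConn` (a chain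
  of `H_i`-lines stays in one point and inside that point's line set), `mem_lineVerts_labelLines`, `labelLines_nonempty`, ★ `lConn_labelLines` (EACH POINT's LINE
  SET IS CONNECTED), `eq_of_klab_eq_of_not_mem` (an untouched vertex is its own point), ★ `card_image_klab_univ` (`#labels = #untouched + #points(H_i)`),
  ★★ `card_kruskalTreeUpTo_add` (`#tree lines(i) + #points(H_i) = |V(H_i)|`), `sum_prefixLines_eq`, `card_filter_isTreePos_eq`, `lineVerts_labelLines_eq`,
  `prefixDeg_eq` (`D(H_i) = Σ_{H_i} e + dV·#tree lines(i)`).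
* ★★ **`prefixDeg_eq_sum_subDeg`** (`D(H_i) = Σ_{points c of H_i} D(labelLines c)`), ★★ **`lt_prefixDeg_of_posSubgraphsBy`** (`PosSubgraphsBy γ₁`, `γ₁ ≥ 0`,
  `1 ≤ i`, `1 ≤ m` ⇒ `γ₁ < D(H_i)`).
HONEST SCOPE.  Pure combinatorics (no propagators); the passage to `kingDegList`∕`PosDegreesBy` and to Prop. 3.6 is part Δ-b; that King's RENORMALISED graphs
satisfy the subgraph condition (§3.5 ∕ [Ba3]) is NOT typed.  Locators: [King1986] (3.66) p.663 (foot), p.664 («every subgraph have positive degree»), (3.77) p.666.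
-/
noncomputable section

namespace Summit.QuantumFields.YangMills.BalabanUVNodes.N15KingModelRung.Graph

open scoped BigOperators
open Finset

section Subgraphs
variable {nn m : ℕ} (src tgt : Fin m → Fin (nn + 1))

/-! ## §1 Line sets, their vertices, the subgraphs `H_i` and their points -/

/-- the VERTICES of a set of lines (King's «the line and its two vertices»). [cite: King1986, (3.66) p.663] -/
def lineVerts (S : Finset (Fin m)) : Finset (Fin (nn + 1)) := S.image src ∪ S.image tgt

/-- the LINES OF `H_i`: the first `i` lines of the ordering `π`. [cite: King1986, (3.66) p.663] -/
def prefixLines (π : Equiv.Perm (Fin m)) (i : ℕ) : Finset (Fin m) := ((univ : Finset (Fin m)).filter fun q : Fin m => ((q : ℕ)) < i).image π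

/-- the lines of `H_i` lying INSIDE THE POINT `c` of the shrunk graph (Kruskal label `c` after `i` steps). [cite: King1986, p.664 («shrunk l(1) to a point»)] -/
def labelLines (π : Equiv.Perm (Fin m)) (i : ℕ) (c : Fin (nn + 1)) : Finset (Fin m) :=
  (prefixLines π i).filter fun ℓ => klab src tgt π i (src ℓ) = c

/-- **KING's DEGREE OF A SUB-LINE-SET** `D(S) = dV·(|V(S)| − 1) + Σ_{ℓ∈S} e_ℓ` (the vertex sums of all but one vertex, the size powers of the lines).
[cite: King1986, (3.66)–(3.69) p.664] -/
def subDeg (dV : ℝ) (e : Fin m → ℝ) (S : Finset (Fin m)) : ℝ := dV * (((lineVerts src tgt S).card : ℝ) - 1) + ∑ ℓ ∈ S, e ℓ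

/-- **KING's DEGREE `D(H_i)`** of the subgraph of the first `i` lines of the ordering: `Σ_{q<i} (e_{l(q)} + dV·[l(q) reaches a new point])` — the partial sums of
part Γ-l's `kingDegList`. [cite: King1986, (3.66)–(3.69) p.664, (3.77) p.666] -/
def prefixDeg (dV : ℝ) (e : Fin m → ℝ) (π : Equiv.Perm (Fin m)) (i : ℕ) : ℝ :=
  ∑ q ∈ (univ : Finset (Fin m)).filter (fun q : Fin m => ((q : ℕ)) < i), (e (π q) + if IsTreePos src tgt π q then dV else 0)

/-- **«EVERY SUBGRAPH HAS POSITIVE DEGREE»** (with a margin `γ₁`): every NON-EMPTY line set `S` which is CONNECTED (any two of its vertices are joined through lines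
of `S`) has `D(S) > γ₁`. [cite: King1986, p.664 («renormalised graphs, in which every subgraph has positive degree»)] -/
def PosSubgraphsBy (γ₁ dV : ℝ) (e : Fin m → ℝ) : Prop :=
  ∀ S : Finset (Fin m), S.Nonempty → (∀ u ∈ lineVerts src tgt S, ∀ v ∈ lineVerts src tgt S, LConn src tgt S u v) → γ₁ < subDeg src tgt dV e S

variable {src tgt}

/-- membership in the vertex set of a line set. [folklore] -/
theorem mem_lineVerts {S : Finset (Fin m)} {v : Fin (nn + 1)} : v ∈ lineVerts src tgt S ↔ ∃ ℓ ∈ S, src ℓ = v ∨ tgt ℓ = v := by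
  unfold lineVerts
  rw [mem_union, mem_image, mem_image]
  constructor
  · rintro (⟨ℓ, hℓ, h⟩ | ⟨ℓ, hℓ, h⟩)
    · exact ⟨ℓ, hℓ, Or.inl h⟩
    · exact ⟨ℓ, hℓ, Or.inr h⟩
  · rintro ⟨ℓ, hℓ, h | h⟩
    · exact Or.inl ⟨ℓ, hℓ, h⟩
    · exact Or.inr ⟨ℓ, hℓ, h⟩

/-- the source of a line is one of its vertices. [folklore] -/
theorem src_mem_lineVerts {S : Finset (Fin m)} {ℓ : Fin m} (h : ℓ ∈ S) : src ℓ ∈ lineVerts src tgt S := mem_lineVerts.2 ⟨ℓ, h, Or.inl rfl⟩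

/-- the target of a line is one of its vertices. [folklore] -/
theorem tgt_mem_lineVerts {S : Finset (Fin m)} {ℓ : Fin m} (h : ℓ ∈ S) : tgt ℓ ∈ lineVerts src tgt S := mem_lineVerts.2 ⟨ℓ, h, Or.inr rfl⟩

/-- more lines, more vertices. [folklore] -/
theorem lineVerts_mono {S S' : Finset (Fin m)} (h : S ⊆ S') : lineVerts src tgt S ⊆ lineVerts src tgt S' := fun v hv => by
  obtain ⟨ℓ, hℓ, h'⟩ := mem_lineVerts.1 hv
  exact mem_lineVerts.2 ⟨ℓ, h hℓ, h'⟩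

/-- ★ **CONNECTED THROUGH `T` MEANS EQUAL OR BOTH ON `T`**: a chain of lines of `T` from `u` to `v` is empty (`u = v`) or starts and ends at vertices of `T`.
[folklore] -/
theorem lConn_eq_or_mem_lineVerts {T : Finset (Fin m)} {u v : Fin (nn + 1)} (h : LConn src tgt T u v) :
    u = v ∨ (u ∈ lineVerts src tgt T ∧ v ∈ lineVerts src tgt T) := by
  induction h with
  | rel a b hab =>
      obtain ⟨ℓ, hℓ, ha, hb⟩ := hab
      refine Or.inr ⟨?_, ?_⟩
      · rw [← ha]; exact src_mem_lineVerts hℓ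
      · rw [← hb]; exact tgt_mem_lineVerts hℓ
  | refl a => exact Or.inl rfl
  | symm a b _ ih =>
      rcases ih with h | h
      · exact Or.inl h.symm
      · exact Or.inr ⟨h.2, h.1⟩
  | trans a b c _ _ ih1 ih2 =>
      rcases ih1 with h1 | h1
      · subst h1; exact ih2
      · rcases ih2 with h2 | h2
        · subst h2; exact Or.inr h1
        · exact Or.inr ⟨h1.1, h2.2⟩

/-- membership in `H_i`: the line's position is `< i`. [cite: King1986, (3.66) p.663] -/
theorem mem_prefixLines {π : Equiv.Perm (Fin m)} {i : ℕ} {ℓ : Fin m} : ℓ ∈ prefixLines π i ↔ ((π.symm ℓ : ℕ)) < i := by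
  unfold prefixLines
  simp only [mem_image, mem_filter, mem_univ, true_and]
  constructor
  · rintro ⟨q, hq, rfl⟩; rwa [Equiv.symm_apply_apply]
  · intro h; exact ⟨π.symm ℓ, h, π.apply_symm_apply ℓ⟩

/-- the line at a position `< i` belongs to `H_i`. [cite: King1986, (3.66) p.663] -/
theorem apply_mem_prefixLines {π : Equiv.Perm (Fin m)} {i : ℕ} {q : Fin m} (hq : ((q : ℕ)) < i) : π q ∈ prefixLines π i := by
  rw [mem_prefixLines, Equiv.symm_apply_apply]; exact hq

/-- the tree lines among the first `i` positions are lines of `H_i`. [cite: King1986, (3.66) p.663] -/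
theorem kruskalTreeUpTo_subset_prefixLines {π : Equiv.Perm (Fin m)} {i : ℕ} : kruskalTreeUpTo src tgt π i ⊆ prefixLines π i := fun ℓ h => by
  rw [mem_kruskalTreeUpTo] at h
  exact mem_prefixLines.2 h.1

/-- a line of `H_i` is internal to a point of the shrunk graph: its endpoints carry the same label after `i` steps. [cite: King1986, p.664] -/
theorem klab_ends_eq_of_mem_prefixLines {π : Equiv.Perm (Fin m)} {i : ℕ} {ℓ : Fin m} (h : ℓ ∈ prefixLines π i) :
    klab src tgt π i (src ℓ) = klab src tgt π i (tgt ℓ) := by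
  have h' := klab_src_eq_tgt (src := src) (tgt := tgt) (π := π) (π.symm ℓ) i (Nat.succ_le_of_lt (mem_prefixLines.1 h))
  rwa [π.apply_symm_apply] at h'

/-- ★ **A CHAIN OF `H_i`-LINES STAYS IN ONE POINT AND INSIDE THAT POINT's LINE SET**: if `u`, `v` are joined through lines of `H_i`, they carry the same label and are
joined through the lines of `H_i` of that label. [cite: King1986, p.664 («shrunk … to a point»)] -/
theorem lConn_labelLines_of_lConn {π : Equiv.Perm (Fin m)} {i : ℕ} {u v : Fin (nn + 1)} (h : LConn src tgt (prefixLines π i) u v) :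
    klab src tgt π i u = klab src tgt π i v ∧ LConn src tgt (labelLines src tgt π i (klab src tgt π i u)) u v := by
  induction h with
  | rel a b hab =>
      obtain ⟨ℓ, hℓ, ha, hb⟩ := hab
      have hlab : klab src tgt π i a = klab src tgt π i b := by
        rw [← ha, ← hb]; exact klab_ends_eq_of_mem_prefixLines hℓ
      refine ⟨hlab, Relation.EqvGen.rel a b ⟨ℓ, ?_, ha, hb⟩⟩
      unfold labelLines
      rw [mem_filter, ha]
      exact ⟨hℓ, rfl⟩
  | refl a => exact ⟨rfl, Relation.EqvGen.refl a⟩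
  | symm a b _ ih =>
      obtain ⟨h1, h2⟩ := ih
      refine ⟨h1.symm, ?_⟩
      rw [← h1]
      exact h2.symm _ _
  | trans a b c _ _ ih1 ih2 =>
      obtain ⟨h1, h1'⟩ := ih1
      obtain ⟨h2, h2'⟩ := ih2
      refine ⟨h1.trans h2, h1'.trans _ _ _ ?_⟩
      rw [h1]
      exact h2'

/-- the vertices of a point's line set: the vertices of `H_i` carrying that label. [cite: King1986, p.664] -/
theorem mem_lineVerts_labelLines {π : Equiv.Perm (Fin m)} {i : ℕ} {c v : Fin (nn + 1)} :
    v ∈ lineVerts src tgt (labelLines src tgt π i c) ↔ v ∈ lineVerts src tgt (prefixLines π i) ∧ klab src tgt π i v = c := by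
  constructor
  · intro hv
    obtain ⟨ℓ, hℓ, h⟩ := mem_lineVerts.1 hv
    unfold labelLines at hℓ
    rw [mem_filter] at hℓ
    refine ⟨mem_lineVerts.2 ⟨ℓ, hℓ.1, h⟩, ?_⟩
    rcases h with rfl | rfl
    · exact hℓ.2
    · rw [← klab_ends_eq_of_mem_prefixLines hℓ.1]; exact hℓ.2
  · rintro ⟨hv, hc⟩
    obtain ⟨ℓ, hℓ, h⟩ := mem_lineVerts.1 hv
    refine mem_lineVerts.2 ⟨ℓ, ?_, h⟩
    unfold labelLines
    rw [mem_filter]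
    refine ⟨hℓ, ?_⟩
    rcases h with rfl | rfl
    · exact hc
    · rw [klab_ends_eq_of_mem_prefixLines hℓ]; exact hc

/-- every point of `H_i` (label of a vertex of `H_i`) carries at least one line. [cite: King1986, p.664] -/
theorem labelLines_nonempty {π : Equiv.Perm (Fin m)} {i : ℕ} {c : Fin (nn + 1)}
    (hc : c ∈ (lineVerts src tgt (prefixLines π i)).image (klab src tgt π i)) : (labelLines src tgt π i c).Nonempty := by
  obtain ⟨v, hv, rfl⟩ := mem_image.1 hc
  obtain ⟨ℓ, hℓ, h⟩ := mem_lineVerts.1 hv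
  refine ⟨ℓ, ?_⟩
  unfold labelLines
  rw [mem_filter]
  refine ⟨hℓ, ?_⟩
  rcases h with rfl | rfl
  · rfl
  · exact klab_ends_eq_of_mem_prefixLines hℓ

/-- ★ **EACH POINT's LINE SET IS CONNECTED**: two vertices of the lines of `H_i` inside one point are joined through those very lines (part Γ-k
`lConn_of_klab_eq`: equal labels are joined by tree lines among the first `i`, which are `H_i`-lines of the same label). [cite: King1986, p.664] -/
theorem lConn_labelLines {π : Equiv.Perm (Fin m)} {i : ℕ} {c u v : Fin (nn + 1)} (hu : u ∈ lineVerts src tgt (labelLines src tgt π i c))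
    (hv : v ∈ lineVerts src tgt (labelLines src tgt π i c)) : LConn src tgt (labelLines src tgt π i c) u v := by
  obtain ⟨-, huc⟩ := mem_lineVerts_labelLines.1 hu
  obtain ⟨-, hvc⟩ := mem_lineVerts_labelLines.1 hv
  have h1 : LConn src tgt (prefixLines π i) u v :=
    lConn_mono kruskalTreeUpTo_subset_prefixLines (lConn_of_klab_eq (src := src) (tgt := tgt) (π := π) i u v (huc.trans hvc.symm))
  have h2 := (lConn_labelLines_of_lConn h1).2
  rwa [huc] at h2

/-- **AN UNTOUCHED VERTEX IS ITS OWN POINT**: a vertex not on `H_i` shares its label with no other vertex. [cite: King1986, p.664] -/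
theorem eq_of_klab_eq_of_not_mem {π : Equiv.Perm (Fin m)} {i : ℕ} {v w : Fin (nn + 1)} (hv : v ∉ lineVerts src tgt (prefixLines π i))
    (h : klab src tgt π i w = klab src tgt π i v) : w = v := by
  have h1 : LConn src tgt (prefixLines π i) w v :=
    lConn_mono kruskalTreeUpTo_subset_prefixLines (lConn_of_klab_eq (src := src) (tgt := tgt) (π := π) i w v h)
  rcases lConn_eq_or_mem_lineVerts h1 with h2 | h2
  · exact h2
  · exact absurd h2.2 hv

/-! ## §2 Counting: tree lines + points = vertices of `H_i`; `D(H_i)` = the sum of the degrees of the points' line sets -/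

/-- ★ **`#labels after i steps = #untouched vertices + #points of H_i`** (the untouched vertices are their own points, distinct from everything else).
[cite: King1986, p.664] -/
theorem card_image_klab_univ (π : Equiv.Perm (Fin m)) (i : ℕ) :
    ((univ : Finset (Fin (nn + 1))).image (klab src tgt π i)).card
      = (univ \ lineVerts src tgt (prefixLines π i)).card + ((lineVerts src tgt (prefixLines π i)).image (klab src tgt π i)).card := by
  classical
  set T := lineVerts src tgt (prefixLines π i) with hT
  have hU : (univ : Finset (Fin (nn + 1))) = (univ \ T) ∪ T := (sdiff_union_of_subset (subset_univ T)).symm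
  rw [hU, image_union]
  have hdisj : Disjoint ((univ \ T).image (klab src tgt π i)) (T.image (klab src tgt π i)) := by
    rw [disjoint_left]
    intro c hc hc'
    obtain ⟨v, hv, rfl⟩ := mem_image.1 hc
    obtain ⟨w, hw, hwv⟩ := mem_image.1 hc'
    have hv' : v ∉ T := (mem_sdiff.1 hv).2
    exact hv' ((eq_of_klab_eq_of_not_mem hv' hwv) ▸ hw)
  have hinj : Set.InjOn (klab src tgt π i) ↑(univ \ T) := by
    intro v hv v' hv' hvv'
    have hv'T : v' ∉ T := (mem_sdiff.1 (mem_coe.1 hv')).2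
    exact eq_of_klab_eq_of_not_mem hv'T hvv'
  rw [card_union_of_disjoint hdisj, card_image_of_injOn hinj, sdiff_union_of_subset (subset_univ T)]

/-- ★★ **TREE LINES + POINTS = VERTICES OF `H_i`**: `#(tree lines among the first i) + #(points of H_i) = |V(H_i)|` — part Γ-k `card_image_klab_add` read on the
subgraph `H_i` (every tree line merges two points of `H_i`; the untouched vertices do not count). [cite: King1986, p.664 («we have shrunk l(1) to a point»)] -/
theorem card_kruskalTreeUpTo_add (π : Equiv.Perm (Fin m)) (i : ℕ) :
    (kruskalTreeUpTo src tgt π i).card + ((lineVerts src tgt (prefixLines π i)).image (klab src tgt π i)).card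
      = (lineVerts src tgt (prefixLines π i)).card := by
  classical
  have h1 := card_image_klab_add (src := src) (tgt := tgt) (π := π) i
  have h2 := card_image_klab_univ (src := src) (tgt := tgt) π i
  have h3 : (univ \ lineVerts src tgt (prefixLines π i)).card + (lineVerts src tgt (prefixLines π i)).card = nn + 1 := by
    rw [card_sdiff_add_card_eq_card (subset_univ _), card_univ, Fintype.card_fin]
  omega

/-- the sum over the lines of `H_i` is the sum over the first `i` positions. [folklore] -/
theorem sum_prefixLines_eq (π : Equiv.Perm (Fin m)) (i : ℕ) (f : Fin m → ℝ) :
    ∑ ℓ ∈ prefixLines π i, f ℓ = ∑ q ∈ (univ : Finset (Fin m)).filter (fun q : Fin m => ((q : ℕ)) < i), f (π q) := by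
  unfold prefixLines
  rw [sum_image]
  intro x _ y _ h
  exact π.injective h

/-- the number of tree positions `< i` is the number of tree lines among the first `i`. [folklore] -/
theorem card_filter_isTreePos_eq (π : Equiv.Perm (Fin m)) (i : ℕ) :
    ((univ : Finset (Fin m)).filter fun q : Fin m => ((q : ℕ)) < i ∧ IsTreePos src tgt π q).card = (kruskalTreeUpTo src tgt π i).card := by
  unfold kruskalTreeUpTo
  rw [card_image_of_injective _ π.injective]

/-- the vertex set of a point's line set as a filter of `V(H_i)`. [folklore] -/
theorem lineVerts_labelLines_eq (π : Equiv.Perm (Fin m)) (i : ℕ) (c : Fin (nn + 1)) :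
    lineVerts src tgt (labelLines src tgt π i c) = (lineVerts src tgt (prefixLines π i)).filter fun v => klab src tgt π i v = c := by
  ext v
  rw [mem_lineVerts_labelLines, mem_filter]

/-- `D(H_i)` as «line powers of `H_i` + `dV` × number of tree lines». [cite: King1986, (3.66)–(3.69) p.664] -/
theorem prefixDeg_eq (dV : ℝ) (e : Fin m → ℝ) (π : Equiv.Perm (Fin m)) (i : ℕ) :
    prefixDeg src tgt dV e π i = ∑ ℓ ∈ prefixLines π i, e ℓ + dV * (kruskalTreeUpTo src tgt π i).card := by
  unfold prefixDeg
  rw [sum_add_distrib, sum_prefixLines_eq, sum_ite, sum_const_zero, add_zero, sum_const, nsmul_eq_mul, filter_filter, card_filter_isTreePos_eq, mul_comm]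

/-- ★★ **`D(H_i)` IS THE SUM OF THE DEGREES OF THE POINTS' LINE SETS**: `D(H_i) = Σ_{c ∈ points(H_i)} (dV·(|V(labelLines c)| − 1) + Σ_{ℓ ∈ labelLines c} e_ℓ)` — the
lines of `H_i` are partitioned by their point, the vertices of `H_i` likewise, and `#tree lines = |V(H_i)| − #points`. [cite: King1986, (3.66)–(3.69) p.664] -/
theorem prefixDeg_eq_sum_subDeg (dV : ℝ) (e : Fin m → ℝ) (π : Equiv.Perm (Fin m)) (i : ℕ) :
    prefixDeg src tgt dV e π i
      = ∑ c ∈ (lineVerts src tgt (prefixLines π i)).image (klab src tgt π i), subDeg src tgt dV e (labelLines src tgt π i c) := by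
  classical
  set T := lineVerts src tgt (prefixLines π i) with hT
  set P := T.image (klab src tgt π i) with hP
  -- the lines of `H_i` partitioned by the label of their source
  have hmaps : ∀ ℓ ∈ prefixLines π i, klab src tgt π i (src ℓ) ∈ P := fun ℓ hℓ => mem_image_of_mem _ (src_mem_lineVerts hℓ)
  have hlines : ∑ ℓ ∈ prefixLines π i, e ℓ = ∑ c ∈ P, ∑ ℓ ∈ labelLines src tgt π i c, e ℓ := by
    rw [← sum_fiberwise_of_maps_to hmaps]
    rfl
  -- the vertices of `H_i` partitioned by their label
  have hverts : (T.card : ℝ) = ∑ c ∈ P, ((lineVerts src tgt (labelLines src tgt π i c)).card : ℝ) := by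
    have h := card_eq_sum_card_fiberwise (f := klab src tgt π i) (s := T) (t := P) fun v hv => mem_image_of_mem _ hv
    rw [h, Nat.cast_sum]
    refine sum_congr rfl fun c _ => ?_
    rw [lineVerts_labelLines_eq]
  -- tree lines + points = vertices
  have htree : ((kruskalTreeUpTo src tgt π i).card : ℝ) = (T.card : ℝ) - (P.card : ℝ) := by
    have h := card_kruskalTreeUpTo_add (src := src) (tgt := tgt) π i
    rw [← hT, ← hP] at h
    have h' : ((kruskalTreeUpTo src tgt π i).card : ℝ) + (P.card : ℝ) = (T.card : ℝ) := by exact_mod_cast h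
    linarith
  rw [prefixDeg_eq, hlines, htree, hverts]
  unfold subDeg
  rw [sum_add_distrib, ← mul_sum, sum_sub_distrib, sum_const, nsmul_eq_mul, mul_one, add_comm]

/-- ★★ **KING's SUBGRAPH CONDITION BOUNDS EVERY `D(H_i)` FROM BELOW, ALONG EVERY ORDERING**: if every non-empty connected sub-line-set has degree `> γ₁ ≥ 0`, then
`D(H_i) > γ₁` for every ordering `π` and every `1 ≤ i` (with `m ≥ 1` lines) — each point of `H_i` is such a set and there is at least one.
[cite: King1986, p.664 («every subgraph has positive degree»), (3.77) p.666] -/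
theorem lt_prefixDeg_of_posSubgraphsBy {γ₁ dV : ℝ} {e : Fin m → ℝ} (hγ₁ : 0 ≤ γ₁) (hpos : PosSubgraphsBy src tgt γ₁ dV e)
    (π : Equiv.Perm (Fin m)) {i : ℕ} (hi : 1 ≤ i) (hm : 1 ≤ m) : γ₁ < prefixDeg src tgt dV e π i := by
  classical
  rw [prefixDeg_eq_sum_subDeg]
  set T := lineVerts src tgt (prefixLines π i) with hT
  set P := T.image (klab src tgt π i) with hP
  -- every point's line set has degree `> γ₁`
  have hterm : ∀ c ∈ P, γ₁ < subDeg src tgt dV e (labelLines src tgt π i c) := fun c hc =>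
    hpos _ (labelLines_nonempty hc) fun u hu v hv => lConn_labelLines hu hv
  -- there is a point: the line at position `0` lies in `H_i`
  have hne : P.Nonempty := by
    refine ⟨klab src tgt π i (src (π ⟨0, hm⟩)), mem_image_of_mem _ (src_mem_lineVerts (apply_mem_prefixLines ?_))⟩
    exact hi
  obtain ⟨c₀, hc₀⟩ := hne
  rw [← add_sum_erase _ _ hc₀]
  have h0 : 0 ≤ ∑ c ∈ P.erase c₀, subDeg src tgt dV e (labelLines src tgt π i c) :=
    sum_nonneg fun c hc => (hγ₁.trans (hterm c (mem_of_mem_erase hc)).le)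
  linarith [hterm c₀ hc₀]

end Subgraphs

end Summit.QuantumFields.YangMills.BalabanUVNodes.N15KingModelRung.Graph

end
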